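import Literature.InformationTheory.Coding.GF2XArithFP
import Literature.Computability.Complexity.AOWListMatrixFP
import HarnessLib

/-!
# The explicit BCH parity-check matrix is computable in polynomial time (Khot 2005, Thm. 4.1, machine level)

Topic `InformationTheory/Coding`, namespace `Literature.InformationTheory.Coding.GF2X`. Sequel of
`BCHExplicit.lean` (the matrix `bchExplicit t M N` over `GF(2^{M+1}) = 𝔽₂[X]/(f_M)`, `f_M` the
least-bitmask irreducible polynomial of degree `M + 1` = `bitsPoly (canonIrredBits M)`, entry formula
`bchExplicit_apply`) and `GF2XArithFP.lean` (carry-less arithmetic on bitmask numerals computed on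
codes: `clmul`, `powMod`, …, in the typed polynomial-time algebra `CodeFP`). Khot's Thm. 4.1 ends
"The parity check matrix for BCH codes has this property and it can be constructed efficiently";
this file proves the second half for the tree's explicit matrix, as a total functional program with
its `CodeFP` certificate:

* `irrTestL W n L c` — the PRODUCT TEST for irreducibility (no `g, h ∈ L` with `g ⋆ h = c` other
  than the trivial factorisations, `⋆ = clmul`); for `2 ≤ c < 2^{m+1}`, `L = [0, 2^{m+1})`,
  `n = m + 1`, `W = 2(m+1)`: `= true ↔ Irreducible (bitsPoly c)` (`irrTest_eq_true_iff`);
* `irredSearch M N` — the first `c ∈ [2^{M+1}, 2^{M+2})` passing the test, the ranges being capped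
  by the unary budgets `2N`, `4N`; **`irredSearch M N = canonIrredBits M` whenever `2ᴹ ≤ N`**
  (`irredSearch_eq`; for Khot's parameters `N = 2ᴹ`);
* `bchEntryAlg M N f a l j = [bit l of powMod (M+2) f 2^{M+1} (N+1) (j+1) (2a+1)]` and
  **`bchEntryAlg M N (canonIrredBits M) s l j = bchExplicit t M N (s, l) j`** (`bchEntryAlg_eq`, by
  `bchExplicit_apply` and `powMod_spec`);
* `bchTabAlg t M N` — the list matrix (`LMat.tab`, rows `l + (M+1)·s` for `(s, l) ∈ [t] × [M+1]`,
  the order of `finProdFinEquiv`, columns `j < N`) of these entries with `f = irredSearch M N`;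
  `ent_bchTabAlg`: its entries ARE those of `bchExplicit t M N` when `2ᴹ ≤ N`; `toMat_bchTabAlg`;
* **`bchTabFP : CodeFP (unE × unE × unE) LMat.matE (t, M, N) ↦ bchTabAlg t M N`** — from
  `(1ᵗ, 1ᴹ, 1ᴺ)` the matrix is computed on codes by a polynomial-time string function (the search
  costs `O(N)` candidates × `O(N²)` factor pairs × `O(M)`-round products; every dimension is read off
  the unary inputs, so the statement is unconditional).

This is the `P`-component (`khotBCH u σ K k = bchExplicit (20K) (MM u σ K k) (NN u σ K k)`,
`NN = 2^{MM}`, `KhotGapInstancesBCH.lean`) of the data of the one remaining machine-level hypothesis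
of `Literature.Algebra.EuclideanLattices.Khot.gapSVP_const_isNPHardRandomized_of_prop6_of_FP`
(`KhotReduction.lean`). All proved; no facts.

## References

* S. Khot, *Hardness of approximating the shortest vector problem in lattices*, J. ACM 52 (2005)
  789–808, Thm. 4.1.
* R. J. McEliece, *The Theory of Information and Coding*, 2nd ed., CUP 2002, Ch. 9 §9.1.
* D. E. Knuth, *The Art of Computer Programming*, Vol. 2, 3rd ed., 1998, §4.6.1–4.6.3.
* S. Arora, B. Barak, *Computational Complexity: A Modern Approach*, CUP 2009, §1.3.
-/

namespace Literature.InformationTheory.Coding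

namespace GF2X

open Polynomial
open Literature.Computability.Complexity Literature.Computability.Complexity.CodeFP
  Literature.Computability.Complexity.LMat

/-! ### Units and factors of binary polynomials, in bitmask form -/

/-- The only unit bitmask is `1`. [folklore] -/
theorem isUnit_bitsPoly_iff (k : ℕ) : IsUnit (bitsPoly k) ↔ k = 1 := by
  constructor
  · intro h
    have h0 : k ≠ 0 := fun hk => h.ne_zero (by rw [hk, bitsPoly_zero])
    have hd := natDegree_eq_zero_of_isUnit h
    rw [natDegree_bitsPoly] at hd
    rcases Nat.log_eq_zero_iff.1 hd with hlt | hb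
    · omega
    · omega
  · rintro rfl
    rw [bitsPoly_one]
    exact isUnit_one

/-- A factor of a nonzero bitmask polynomial of degree `≤ m` has bitmask `< 2^{m+1}`. [folklore] -/
theorem polyBits_lt_of_dvd {a : (ZMod 2)[X]} {c m : ℕ} (hc0 : c ≠ 0) (hc : c < 2 ^ (m + 1))
    (ha : a ∣ bitsPoly c) : polyBits a < 2 ^ (m + 1) := by
  have hc0' : bitsPoly c ≠ 0 := fun h => hc0 (bitsPoly_eq_zero_iff.1 h)
  exact polyBits_lt_two_pow ((degree_le_of_dvd ha hc0').trans_lt (degree_bitsPoly_lt hc))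

/-! ### The product test for irreducibility -/

/-- **Product test**: `c` passes iff no pair `g, h` from the list `L` has carry-less product `c`
except with `g = 1` or `h = 1` (the definition of irreducibility made finite; efficient tests,
Knuth §4.6.2, are not needed here). [folklore] -/
def irrTestL (W n : ℕ) (L : List ℕ) (c : ℕ) : Bool :=
  L.all fun g => L.all fun h => !(clmul W n g h == c) || (g == 1) || (h == 1)

/-- **The product test decides irreducibility**: for `2 ≤ c < 2^{m+1}` (degree between `1` and
`m`), testing all pairs of bitmasks `< 2^{m+1}` with `m + 1` rounds and width `2(m+1)` returns
`true` iff `bitsPoly c` is irreducible (`Irreducible p ↔ ¬IsUnit p ∧ ∀ a b, p = ab → IsUnit a ∨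
IsUnit b`; a factor of `bitsPoly c` has degree `≤ m`). [folklore] -/
theorem irrTest_eq_true_iff {m c : ℕ} (hc2 : 2 ≤ c) (hc : c < 2 ^ (m + 1)) :
    irrTestL (2 * (m + 1)) (m + 1) (List.range (2 ^ (m + 1))) c = true ↔ Irreducible (bitsPoly c) := by
  have hc0 : c ≠ 0 := by omega
  simp only [irrTestL, List.all_eq_true, List.mem_range, Bool.or_eq_true, Bool.not_eq_true',
    beq_eq_false_iff_ne, ne_eq, beq_iff_eq]
  constructor
  · intro h
    refine irreducible_iff.2 ⟨fun hu => ?_, fun a b hab => ?_⟩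
    · rw [isUnit_bitsPoly_iff] at hu; omega
    · have ha : polyBits a < 2 ^ (m + 1) := polyBits_lt_of_dvd hc0 hc ⟨b, hab⟩
      have hb : polyBits b < 2 ^ (m + 1) := polyBits_lt_of_dvd hc0 hc ⟨a, by rw [hab, mul_comm]⟩
      have hprod : clmul (2 * (m + 1)) (m + 1) (polyBits a) (polyBits b) = c := by
        apply bitsPoly_injective
        rw [clmul_spec ha hb le_rfl, bitsPoly_polyBits, bitsPoly_polyBits, hab]
      rcases h (polyBits a) ha (polyBits b) hb with (hne | h1) | h1
      · exact absurd hprod hne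
      · left; rw [← bitsPoly_polyBits a, h1, bitsPoly_one]; exact isUnit_one
      · right; rw [← bitsPoly_polyBits b, h1, bitsPoly_one]; exact isUnit_one
  · intro h g hg k hk
    by_cases hprod : clmul (2 * (m + 1)) (m + 1) g k = c
    · have hab : bitsPoly c = bitsPoly g * bitsPoly k := by rw [← hprod, clmul_spec hg hk le_rfl]
      rcases h.isUnit_or_isUnit hab with hu | hu
      · exact Or.inl (Or.inr ((isUnit_bitsPoly_iff g).1 hu))
      · exact Or.inr ((isUnit_bitsPoly_iff k).1 hu)
    · exact Or.inl (Or.inl hprod)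

/-! ### The search for the canonical irreducible polynomial -/

/-- First element of a list of candidates passing the product test (`0` if none).
[cite: Mceliece2002, Ch. 9 §9.1] -/
def irredSearchL (W n : ℕ) (cands L : List ℕ) : ℕ :=
  (cands.filter fun c => irrTestL W n L c).headD 0

/-- **The search for `f_M`**: candidates `2^{M+1} + [0, min 2^{M+1} 2N)` (the bitmasks of bit-length
`M + 2`, capped by the budget `2N`), factor range `[0, min 2^{M+2} 4N)`, `M + 2` rounds, width
`2(M+2)`. [cite: Mceliece2002, Ch. 9 §9.1] -/
def irredSearch (M N : ℕ) : ℕ :=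
  irredSearchL (2 * (M + 2)) (M + 2) ((List.range (min (2 ^ (M + 1)) (2 * N))).map fun k => k + 2 ^ (M + 1))
    (List.range (min (2 ^ (M + 2)) (4 * N)))

/-- Head of a filtered image of a range: the image of the first index passing. [folklore] -/
theorem headD_filter_map_range {p : ℕ → Bool} {f : ℕ → ℕ} {B k₀ : ℕ} (hk : k₀ < B)
    (hp : p (f k₀) = true) (hmin : ∀ k < k₀, p (f k) = false) (d : ℕ) :
    (((List.range B).map f).filter p).headD d = f k₀ := by
  obtain ⟨r, rfl⟩ : ∃ r, B = k₀ + (r + 1) := ⟨B - k₀ - 1, by omega⟩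
  rw [List.range_add, List.map_append, List.filter_append, List.range_succ_eq_map, List.map_cons,
    List.map_cons, add_zero, List.filter_cons_of_pos hp]
  have hnil : ((List.range k₀).map f).filter p = [] := by
    rw [List.filter_eq_nil_iff]
    intro a ha
    obtain ⟨k, hk', rfl⟩ := List.mem_map.1 ha
    rw [hmin k (List.mem_range.1 hk')]
    exact Bool.false_ne_true
  rw [hnil, List.nil_append, List.headD_cons]

/-- **The search returns `canonIrredBits M` whenever `2ᴹ ≤ N`** (then the caps are inactive:
`min 2^{M+1} 2N = 2^{M+1}`, `min 2^{M+2} 4N = 2^{M+2}`), by the minimality of `canonIrredBits M`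
(`canonIrredBits_spec`, `canonIrredBits_min`) and `irrTest_eq_true_iff`. [cite: Mceliece2002, Ch. 9 §9.1] -/
theorem irredSearch_eq {M N : ℕ} (h : 2 ^ M ≤ N) : irredSearch M N = canonIrredBits M := by
  obtain ⟨h1, h2, hirr⟩ := canonIrredBits_spec M
  have hmin1 : min (2 ^ (M + 1)) (2 * N) = 2 ^ (M + 1) := min_eq_left (by rw [pow_succ]; omega)
  have hmin2 : min (2 ^ (M + 2)) (4 * N) = 2 ^ (M + 2) :=
    min_eq_left (by rw [pow_succ, pow_succ]; omega)
  unfold irredSearch irredSearchL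
  rw [hmin1, hmin2]
  have hk : canonIrredBits M - 2 ^ (M + 1) < 2 ^ (M + 1) := by rw [pow_succ] at h2; omega
  rw [headD_filter_map_range (k₀ := canonIrredBits M - 2 ^ (M + 1)) hk]
  · omega
  · rw [show canonIrredBits M - 2 ^ (M + 1) + 2 ^ (M + 1) = canonIrredBits M by omega,
      show 2 * (M + 2) = 2 * (M + 1 + 1) by ring]
    have h2le : 2 ≤ canonIrredBits M := by
      have h1' := h1
      have := Nat.one_le_two_pow (n := M)
      rw [pow_succ] at h1'
      omega
    exact (irrTest_eq_true_iff (m := M + 1) h2le h2).2 hirr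
  · intro k hk'
    have hlo : 2 ^ (M + 1) ≤ k + 2 ^ (M + 1) := Nat.le_add_left _ _
    have hlt : k + 2 ^ (M + 1) < canonIrredBits M := by omega
    rw [Bool.eq_false_iff]
    intro ht
    rw [show 2 * (M + 2) = 2 * (M + 1 + 1) by ring] at ht
    exact canonIrredBits_min M hlo hlt
      ((irrTest_eq_true_iff (m := M + 1) (by have := Nat.one_le_two_pow (n := M + 1); omega)
        (hlt.trans h2)).1 ht)

/-! ### The entries -/

/-- **The entry program**: bit `l` of `(bitsPoly (j+1))^{2a+1} mod f` computed by `powMod` with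
width `M + 2`, `P = 2^{M+1}`, `N + 1` rounds per product (enough for the locator `j + 1 ≤ N`),
`2a + 1` products. [cite: Khot2005, Thm. 4.1; Mceliece2002, Ch. 9 §9.1] -/
def bchEntryAlg (M N f a l j : ℕ) : ℤ :=
  if (powMod (M + 2) f (2 ^ (M + 1)) (N + 1) (j + 1) (2 * a + 1)).testBit l then 1 else 0

/-- Every entry of the program is `0` or `1`. [folklore] -/
theorem bchEntryAlg_zero_or_one (M N f a l j : ℕ) : bchEntryAlg M N f a l j = 0 ∨ bchEntryAlg M N f a l j = 1 := by
  unfold bchEntryAlg; split_ifs <;> simp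

/-- **The entry program computes the entries of `bchExplicit`** (with the true `f_M`):
`bchEntryAlg M N (canonIrredBits M) s l j = bchExplicit t M N (s, l) j`, by the entry formula
`bchExplicit_apply` and `powMod_spec`. [cite: Khot2005, Thm. 4.1; Mceliece2002, Ch. 9 §9.1] -/
theorem bchEntryAlg_eq {t M N : ℕ} (s : Fin t) (l : Fin (M + 1)) (j : Fin N) :
    bchEntryAlg M N (canonIrredBits M) s l j = bchExplicit t M N (s, l) j := by
  obtain ⟨hf1, hf2, _⟩ := canonIrredBits_spec M
  have hj : (j : ℕ) + 1 < 2 ^ (N + 1) :=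
    lt_of_le_of_lt (Nat.succ_le_of_lt j.isLt) (Nat.lt_two_pow_self.trans (Nat.pow_lt_pow_right (by norm_num) (by omega)))
  obtain ⟨hspec, _⟩ := powMod_spec (m := M + 1) (W := M + 2) (by omega) hf1 hf2 le_rfl hj (2 * (s : ℕ) + 1)
  rw [bchExplicit_apply, canonIrred, ← hspec, coeff_bitsPoly]
  unfold bchEntryAlg
  split_ifs <;> rfl

/-! ### The table -/

/-- **The BCH table program**: `t·(M+1)` rows (row `l + (M+1)·s` for `(s, l)`), `N` columns, entries
by `bchEntryAlg` with the searched modulus `irredSearch M N`. [cite: Khot2005, Thm. 4.1] -/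
def bchTabAlg (t M N : ℕ) : List (List ℤ) :=
  tab (t * (M + 1)) N fun i j => bchEntryAlg M N (irredSearch M N) (i / (M + 1)) (i % (M + 1)) j

/-- The table has `t·(M+1)` rows. [folklore] -/
theorem length_bchTabAlg (t M N : ℕ) : (bchTabAlg t M N).length = t * (M + 1) := length_tab _ _ _

/-- Every row of the table has `N` entries. [folklore] -/
theorem length_of_mem_bchTabAlg {t M N : ℕ} {r : List ℤ} (h : r ∈ bchTabAlg t M N) : r.length = N :=
  (mem_tab h).1

/-- The flattened row index of `(s, l)` (the order of `finProdFinEquiv`). [folklore] -/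
theorem row_index_lt {t M : ℕ} (s : Fin t) (l : Fin (M + 1)) : (l : ℕ) + (M + 1) * s < t * (M + 1) := by
  have hs := s.isLt; have hl := l.isLt
  calc (l : ℕ) + (M + 1) * s < (M + 1) + (M + 1) * s := by omega
    _ = (M + 1) * (s + 1) := by ring
    _ ≤ (M + 1) * t := Nat.mul_le_mul_left _ hs
    _ = t * (M + 1) := mul_comm _ _

/-- **The table program computes `bchExplicit`**: for `2ᴹ ≤ N`, the entry of `bchTabAlg t M N` in row
`l + (M+1)·s` and column `j` is `bchExplicit t M N (s, l) j`. [cite: Khot2005, Thm. 4.1] -/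
theorem ent_bchTabAlg {t M N : ℕ} (h : 2 ^ M ≤ N) (s : Fin t) (l : Fin (M + 1)) (j : Fin N) :
    ent (bchTabAlg t M N) ((l : ℕ) + (M + 1) * s) j = bchExplicit t M N (s, l) j := by
  rw [bchTabAlg, ent_tab _ (row_index_lt s l) j.isLt, irredSearch_eq h, ← bchEntryAlg_eq s l j]
  have hl := l.isLt
  congr 1
  · rw [Nat.add_mul_div_left _ _ (Nat.succ_pos M), Nat.div_eq_of_lt hl, zero_add]
  · rw [Nat.add_mul_mod_self_left, Nat.mod_eq_of_lt hl]

/-- The same through `finProdFinEquiv : Fin t × Fin (M+1) ≃ Fin (t·(M+1))` and `LMat.toMat`: the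
matrix of the table is `bchExplicit t M N` with its rows re-indexed. [cite: Khot2005, Thm. 4.1] -/
theorem toMat_bchTabAlg {t M N : ℕ} (h : 2 ^ M ≤ N) (s : Fin t) (l : Fin (M + 1)) (j : Fin N) :
    toMat (t * (M + 1)) N (bchTabAlg t M N) (finProdFinEquiv (s, l)) j = bchExplicit t M N (s, l) j := by
  rw [toMat, finProdFinEquiv_apply_val]
  exact ent_bchTabAlg h s l j


/-! ### Polynomial time: the test, the search, the entries and the table on codes -/

/-- `tab` depends only on the values of the entry function inside the range. [folklore] -/
theorem tab_congr {N₁ N₂ : ℕ} {f g : ℕ → ℕ → ℤ} (h : ∀ i < N₁, ∀ j < N₂, f i j = g i j) :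
    tab N₁ N₂ f = tab N₁ N₂ g := by
  unfold tab
  exact List.map_congr_left fun i hi => List.map_congr_left fun j hj =>
    h i (List.mem_range.1 hi) j (List.mem_range.1 hj)

/-- Code of a test context `(1ᵂ, 1ⁿ, c)`. [folklore] -/
abbrev tstE : ℕ × ℕ × ℕ → List Bool := pairE unE (pairE unE natE)

/-- **The product test on codes**: `((1ᵂ, 1ⁿ, c), L) ↦ irrTestL W n L c` (two nested `all` over `L`
around `clmul`). [cite: AroraBarak2009, §1.3] -/
theorem irrTestLFP : CodeFP (pairE tstE (rawE natE)) bitE (fun p => irrTestL p.1.1 p.1.2.1 p.2 p.1.2.2) := by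
  -- inner predicate on `((ctx, g), h)`
  let iE : (ℕ × ℕ × ℕ) × ℕ × ℕ → List Bool := fun q => pairE (pairE tstE natE) natE ((q.1, q.2.1), q.2.2)
  have hW : CodeFP (pairE (pairE tstE natE) natE) unE (fun q => q.1.1.1) := (fst _ _).fst'.fst'
  have hn : CodeFP (pairE (pairE tstE natE) natE) unE (fun q => q.1.1.2.1) := (fst _ _).fst'.snd'.fst'
  have hc : CodeFP (pairE (pairE tstE natE) natE) natE (fun q => q.1.1.2.2) := (fst _ _).fst'.snd'.snd'
  have hg : CodeFP (pairE (pairE tstE natE) natE) natE (fun q => q.1.2) := (fst _ _).snd'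
  have hh : CodeFP (pairE (pairE tstE natE) natE) natE (fun q => q.2) := snd _ _
  have hcl : CodeFP (pairE (pairE tstE natE) natE) natE (fun q => clmul q.1.1.1 q.1.1.2.1 q.1.2 q.2) :=
    clmulFP.comp (hW.pair (hn.pair (hg.pair hh)))
  have one : CodeFP (pairE (pairE tstE natE) natE) natE (fun _ => (1 : ℕ)) := const _ 1
  have hin : CodeFP (pairE (pairE tstE natE) natE) bitE
      (fun q => !(clmul q.1.1.1 q.1.1.2.1 q.1.2 q.2 == q.1.1.2.2) || (q.1.2 == 1) || (q.2 == 1)) :=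
    ((((beq natE_injective).comp (hcl.pair hc)).not.or ((beq natE_injective).comp (hg.pair one))).or
      ((beq natE_injective).comp (hh.pair one)) :)
  -- inner `all` over `L` on `((ctx, g), L)`; outer predicate on `((ctx, L), g)`
  have hout : CodeFP (pairE (pairE tstE (rawE natE)) natE) bitE
      (fun q => q.1.2.all fun h => !(clmul q.1.1.1 q.1.1.2.1 q.2 h == q.1.1.2.2) || (q.2 == 1) || (h == 1)) :=
    ((all hin).comp (((fst _ _).fst'.pair (snd _ _)).pair (fst _ _).snd') :)
  exact ((all hout).comp ((CodeFP.id _).pair (snd _ _))).congr fun p => rfl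

/-- **The search on codes**: `((1ᵂ, 1ⁿ), cands, L) ↦ irredSearchL W n cands L` (`filter` by the test,
then the head). [cite: AroraBarak2009, §1.3] -/
theorem irredSearchLFP : CodeFP (pairE (pairE unE unE) (pairE (rawE natE) (rawE natE))) natE
    (fun p => irredSearchL p.1.1 p.1.2 p.2.1 p.2.2) := by
  -- context `σ = ((W, n), L)`, items the candidates
  have hp : CodeFP (pairE (pairE (pairE unE unE) (rawE natE)) natE) bitE
      (fun q => irrTestL q.1.1.1 q.1.1.2 q.1.2 q.2) :=
    (irrTestLFP.comp (((fst _ _).fst'.fst'.pair ((fst _ _).fst'.snd'.pair (snd _ _))).pair (fst _ _).snd') :)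
  have hh := (rawHeadD natE (d := (0 : ℕ)) natE_zero).comp (filter hp)
  exact (hh.comp (((fst _ _).pair (snd _ _).snd').pair (snd _ _).fst')).congr fun p => rfl

/-- **`(1ᴹ, 1ᴺ) ↦ irredSearch M N` is computed on codes in polynomial time** (the ranges come from
the unary budgets `2N`, `4N` by `brange`). [cite: AroraBarak2009, §1.3; Mceliece2002, Ch. 9 §9.1] -/
theorem irredSearchFP : CodeFP (pairE unE unE) natE (fun p => irredSearch p.1 p.2) := by
  have hM : CodeFP (pairE unE unE) unE Prod.fst := fst _ _
  have hN : CodeFP (pairE unE unE) unE Prod.snd := snd _ _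
  have hM1 : CodeFP (pairE unE unE) unE (fun p => p.1 + 1) := unSucc.comp hM
  have hM2 : CodeFP (pairE unE unE) unE (fun p => p.1 + 2) := (unSucc.comp hM1).congr fun p => rfl
  have hW : CodeFP (pairE unE unE) unE (fun p => 2 * (p.1 + 2)) :=
    (unAdd.comp (hM2.pair hM2)).congr fun p => by simp only; ring
  have hP1 : CodeFP (pairE unE unE) natE (fun p => 2 ^ (p.1 + 1)) := natPow.comp ((const _ 2).pair hM1)
  have hP2 : CodeFP (pairE unE unE) natE (fun p => 2 ^ (p.1 + 2)) := natPow.comp ((const _ 2).pair hM2)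
  have h2N : CodeFP (pairE unE unE) unE (fun p => 2 * p.2) := (unAdd.comp (hN.pair hN)).congr fun p => by
    simp only; ring
  have h4N : CodeFP (pairE unE unE) unE (fun p => 4 * p.2) := (unAdd.comp (h2N.pair h2N)).congr fun p => by
    simp only; ring
  have hr1 : CodeFP (pairE unE unE) (rawE natE) (fun p => List.range (min (2 ^ (p.1 + 1)) (2 * p.2))) :=
    ((brange unitE).comp ((replicateUnit.comp h2N).pair hP1)).congr fun p => by simp
  have hL : CodeFP (pairE unE unE) (rawE natE) (fun p => List.range (min (2 ^ (p.1 + 2)) (4 * p.2))) :=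
    ((brange unitE).comp ((replicateUnit.comp h4N).pair hP2)).congr fun p => by simp
  have hm : CodeFP (pairE natE (rawE natE)) (rawE natE) (fun q => q.2.map fun k => k + q.1) :=
    map (natAdd.comp ((snd _ _).pair (fst _ _)))
  have hcands : CodeFP (pairE unE unE) (rawE natE)
      (fun p => (List.range (min (2 ^ (p.1 + 1)) (2 * p.2))).map fun k => k + 2 ^ (p.1 + 1)) :=
    hm.comp (hP1.pair hr1)
  exact (irredSearchLFP.comp ((hW.pair hM2).pair (hcands.pair hL))).congr fun p => rfl

/-- The entry program with the row index split by the machine (`a = i / (M+1)` capped by `t` to be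
usable as a unary exponent, `l = i mod (M+1)` capped by `M + 1`); inside the table it agrees with
`bchEntryAlg` (`bchEntryAlg'_eq`). [cite: Khot2005, Thm. 4.1] -/
def bchEntryAlg' (t M N f i j : ℕ) : ℤ :=
  if (powMod (M + 2) f (2 ^ (M + 1)) (N + 1) (j + 1)
      (min (i / (M + 1)) t + min (i / (M + 1)) t + 1)).testBit (min (i % (M + 1)) (M + 1)) then 1 else 0

/-- Inside the table the caps are inactive. [folklore] -/
theorem bchEntryAlg'_eq {t M N i : ℕ} (f j : ℕ) (hi : i < t * (M + 1)) :
    bchEntryAlg' t M N f i j = bchEntryAlg M N f (i / (M + 1)) (i % (M + 1)) j := by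
  have ha : i / (M + 1) < t := Nat.div_lt_of_lt_mul (by rwa [mul_comm] at hi)
  have hl : i % (M + 1) < M + 1 := Nat.mod_lt _ (Nat.succ_pos M)
  unfold bchEntryAlg' bchEntryAlg
  rw [min_eq_left ha.le, min_eq_left hl.le, ← two_mul]

/-- Code of the entry context `((1^{M+2}, f, 2^{M+1}), M + 1, 1^{M+1}, 1ᵗ, 1^{N+1})`. [folklore] -/
abbrev entE : (ℕ × ℕ × ℕ) × ℕ × ℕ × ℕ × ℕ → List Bool := pairE ctxE (pairE natE (pairE unE (pairE unE unE)))

/-- **The entries on codes** (context `((1ᵂ, f, P), M₁, 1^{M₁}, 1ᵗ, 1ⁿ)`, arguments `(i, j)`): division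
of the row index, unary caps, `powMod`, bit test. [cite: AroraBarak2009, §1.3; Khot2005, Thm. 4.1] -/
theorem bchEntryFP : CodeFP (pairE entE (pairE natE natE)) intE
    (fun q => if (powMod q.1.1.1 q.1.1.2.1 q.1.1.2.2 q.1.2.2.2.2 (q.2.2 + 1)
      (min (q.2.1 / q.1.2.1) q.1.2.2.2.1 + min (q.2.1 / q.1.2.1) q.1.2.2.2.1 + 1)).testBit
        (min (q.2.1 % q.1.2.1) q.1.2.2.1) then (1 : ℤ) else 0) := by
  let E := pairE entE (pairE natE natE)
  have hκ : CodeFP E ctxE (fun q => q.1.1) := (fst _ _).fst'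
  have hM1n : CodeFP E natE (fun q => q.1.2.1) := (fst _ _).snd'.fst'
  have hM1u : CodeFP E unE (fun q => q.1.2.2.1) := (fst _ _).snd'.snd'.fst'
  have ht : CodeFP E unE (fun q => q.1.2.2.2.1) := (fst _ _).snd'.snd'.snd'.fst'
  have hn : CodeFP E unE (fun q => q.1.2.2.2.2) := (fst _ _).snd'.snd'.snd'.snd'
  have hi : CodeFP E natE (fun q => q.2.1) := (snd _ _).fst'
  have hj : CodeFP E natE (fun q => q.2.2) := (snd _ _).snd'
  have ha : CodeFP E unE (fun q => min (q.2.1 / q.1.2.1) q.1.2.2.2.1) :=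
    unOfNatMin.comp (ht.pair (natDiv.comp (hi.pair hM1n)))
  have he : CodeFP E unE (fun q => min (q.2.1 / q.1.2.1) q.1.2.2.2.1 + min (q.2.1 / q.1.2.1) q.1.2.2.2.1 + 1) :=
    unSucc.comp (unAdd.comp (ha.pair ha))
  have hl : CodeFP E unE (fun q => min (q.2.1 % q.1.2.1) q.1.2.2.1) :=
    unOfNatMin.comp (hM1u.pair (natMod.comp (hi.pair hM1n)))
  have hj1 : CodeFP E natE (fun q => q.2.2 + 1) := natAdd.comp (hj.pair (const _ 1))
  have hx : CodeFP E natE (fun q => powMod q.1.1.1 q.1.1.2.1 q.1.1.2.2 q.1.2.2.2.2 (q.2.2 + 1)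
      (min (q.2.1 / q.1.2.1) q.1.2.2.2.1 + min (q.2.1 / q.1.2.1) q.1.2.2.2.1 + 1)) :=
    (powModFP.comp (hκ.pair (hn.pair (hj1.pair he))) :)
  have hbit := natTestBitFP.comp (hx.pair hl)
  exact ((hbit.ite (const _ (1 : ℤ)) (const _ (0 : ℤ))) :)

/-- **Khot 2005, Thm. 4.1, "can be constructed efficiently", for the tree's explicit matrix**:
`(1ᵗ, 1ᴹ, 1ᴺ) ↦ bchTabAlg t M N` — for `2ᴹ ≤ N` the list matrix of `bchExplicit t M N`
(`ent_bchTabAlg`) — is computed on codes by a polynomial-time string function.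
[cite: Khot2005, Thm. 4.1; AroraBarak2009, §1.3] -/
theorem bchTabFP : CodeFP (pairE unE (pairE unE unE)) matE (fun p => bchTabAlg p.1 p.2.1 p.2.2) := by
  let I := pairE unE (pairE unE unE)
  have ht : CodeFP I unE (fun p => p.1) := fst _ _
  have hM : CodeFP I unE (fun p => p.2.1) := (snd _ _).fst'
  have hN : CodeFP I unE (fun p => p.2.2) := (snd _ _).snd'
  have hM1 : CodeFP I unE (fun p => p.2.1 + 1) := unSucc.comp hM
  have hM2 : CodeFP I unE (fun p => p.2.1 + 2) := (unSucc.comp hM1).congr fun p => rfl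
  have hN1 : CodeFP I unE (fun p => p.2.2 + 1) := unSucc.comp hN
  have hf : CodeFP I natE (fun p => irredSearch p.2.1 p.2.2) := irredSearchFP.comp (hM.pair hN)
  have hP1 : CodeFP I natE (fun p => 2 ^ (p.2.1 + 1)) := natPow.comp ((const _ 2).pair hM1)
  have hκ : CodeFP I ctxE (fun p => (p.2.1 + 2, irredSearch p.2.1 p.2.2, 2 ^ (p.2.1 + 1))) :=
    hM2.pair (hf.pair hP1)
  have hσ : CodeFP I entE (fun p => ((p.2.1 + 2, irredSearch p.2.1 p.2.2, 2 ^ (p.2.1 + 1)),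
      p.2.1 + 1, p.2.1 + 1, p.1, p.2.2 + 1)) :=
    hκ.pair ((natOfUn.comp hM1).pair (hM1.pair (ht.pair hN1)))
  have hrows : CodeFP I unE (fun p => p.1 * (p.2.1 + 1)) :=
    ((ulength unitE).comp (unitsMul.comp ((replicateUnit.comp ht).pair (replicateUnit.comp hM1)))).congr
      fun p => by simp
  have h := (tabFP bchEntryFP).comp (hσ.pair (hrows.pair hN))
  refine h.congr fun p => ?_
  obtain ⟨t, M, N⟩ := p
  unfold bchTabAlg
  refine tab_congr fun i hi j _ => ?_
  rw [← bchEntryAlg'_eq (irredSearch M N) j hi]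
  rfl

end GF2X

end Literature.InformationTheory.Coding
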